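import Summits.PneNP.PneNP.Theorems.SymmetryBudgetNoHiddenOrderPerPathAtoms

/-!
# Atoms of one block partition it (per-path canoniser, `NoHiddenOrder`, (R2a) of PER-PATH.md §11–§12)

Route `PneNP/SymmetryBudget`, `NoHiddenOrder` (stmt-PneNP-14781). For the assembly step of the pointer-indexed canonical form the
atoms `atom G W c u`, `u ∈ W` (`…PerPathAtomsDefs/Atoms.lean`: the fixed point of iterated splitting by switching components)
must PARTITION the block `W`. This file proves it:

* `swReach_subset_of_closed` — `swReach G B c v` is the least subset of `B` containing `v` and closed under switching
  adjacency inside `B`; `mem_swReach_comm` — reachability is symmetric; `swReach_eq_of_mem` — a reached vertex reaches the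
  same set;
* `atom_eq_empty_of_not_mem`; `iterate_atomStep_eq_of_mem`, **`atom_eq_of_mem`** — if `u' ∈ atom G W c u` then `atom G W c u' = atom G W c u`; hence
  **`atom_eq_or_disjoint`**.

No definitions; builds on the two landed atom files.
-/

-- `Summit.PneNP.PneNP.…` duplicates `PneNP` BY DESIGN (single-problem summit, D-0017 layout).
set_option linter.dupNamespace false

namespace Summit.PneNP.PneNP.Theorems

open Finset

namespace BranchSum

variable {V : Type*} [DecidableEq V] {G : SimpleGraph V} [DecidableRel G.Adj]

/-- **Minimality of `swReach`**: a subset of `B` that contains `v` and is closed under switching adjacency inside `B` contains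
`swReach G B c v`. -/
theorem swReach_subset_of_closed {B S : Finset V} (c : V → ℕ) {v : V} (hvS : v ∈ S)
    (hcl : ∀ a ∈ S, ∀ b ∈ B, (swGraph G B c).Adj a b → b ∈ S) : swReach G B c v ⊆ S := by
  have key : ∀ n, (swExpand G B c)^[n] ({v} ∩ B) ⊆ S := by
    intro n
    induction n with
    | zero => intro x hx; rw [Function.iterate_zero, id_eq, mem_inter, mem_singleton] at hx; exact hx.1 ▸ hvS
    | succ n ih =>
      rw [Function.iterate_succ_apply', swExpand]
      refine union_subset ih fun b hb => ?_
      rw [mem_filter] at hb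
      obtain ⟨a, ha, hab⟩ := hb.2
      exact hcl a (ih ha) b hb.1 hab
  exact key _

/-- **Reachability is symmetric**: if `u' ∈ swReach G B c u` then `u ∈ swReach G B c u'`. -/
theorem mem_swReach_comm {B : Finset V} (c : V → ℕ) {u u' : V} (hu : u ∈ B) (h : u' ∈ swReach G B c u) :
    u ∈ swReach G B c u' := by
  by_contra hnot
  -- the complement of `swReach … u'` in `B` is closed and contains `u`, hence contains `swReach … u ∋ u'`
  set X := swReach G B c u' with hX
  have hcl : ∀ a ∈ B \ X, ∀ b ∈ B, (swGraph G B c).Adj a b → b ∈ B \ X := by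
    intro a ha b hb hab
    rw [mem_sdiff] at ha ⊢
    refine ⟨hb, fun hbX => ha.2 ?_⟩
    exact swReach_closed c u' hbX ha.1 hab.symm
  have hsub := swReach_subset_of_closed (G := G) c (mem_sdiff.2 ⟨hu, hnot⟩) hcl
  have hu'B : u' ∈ B := swReach_subset B c u h
  exact (mem_sdiff.1 (hsub h)).2 (self_mem_swReach c hu'B)

/-- A reached vertex reaches exactly the same set. -/
theorem swReach_eq_of_mem {B : Finset V} (c : V → ℕ) {u u' : V} (hu : u ∈ B) (h : u' ∈ swReach G B c u) :
    swReach G B c u' = swReach G B c u := by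
  have hu'B : u' ∈ B := swReach_subset B c u h
  apply Subset.antisymm
  · exact swReach_subset_of_closed c h fun a ha b hb hab => swReach_closed c u ha hb hab
  · exact swReach_subset_of_closed c (mem_swReach_comm c hu h) fun a ha b hb hab => swReach_closed c u' ha hb hab

/-- Along the atom iteration, a vertex of the final atom of `u` produces the same blocks as `u` at every round. -/
theorem iterate_atomStep_eq_of_mem {W : Finset V} (c : V → ℕ) {u u' : V} (hu : u ∈ W) (h : u' ∈ atom G W c u) (n : ℕ) :
    (fun B => swReach G B c u')^[n] W = (fun B => swReach G B c u)^[n] W := by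
  induction n with
  | zero => rfl
  | succ n ih =>
    rw [Function.iterate_succ_apply', Function.iterate_succ_apply', ih]
    -- `u'` lies in the round-`(n+1)` block of `u` (the atom is inside every round)
    have hmem : u' ∈ (fun B => swReach G B c u)^[n + 1] W := by
      have hle : n + 1 ≤ W.card + 1 ∨ W.card + 1 ≤ n + 1 := le_total _ _
      rcases hle with hle | hle
      · -- the atom is inside every earlier round
        have hsub : atom G W c u ⊆ (fun B => swReach G B c u)^[n + 1] W := by
          unfold atom
          obtain ⟨k, hk⟩ := Nat.exists_eq_add_of_le hle
          rw [hk]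
          clear hk
          induction k with
          | zero => exact Subset.rfl
          | succ k ihk =>
            rw [Nat.add_succ]
            exact (iterate_atomStep_succ_subset W c u _).trans ihk
        exact hsub h
      · -- beyond the fixed point all rounds equal the atom
        obtain ⟨m, hm, hfix⟩ := exists_atomStep_fixed (G := G) W c u
        have hst := iterate_atomStep_stable W c u hfix
        have h1 : (fun B => swReach G B c u)^[n + 1] W = (fun B => swReach G B c u)^[m] W := hst (n + 1) (by omega)
        have h2 : atom G W c u = (fun B => swReach G B c u)^[m] W := hst (W.card + 1) (by omega)
        rw [h1, ← h2]; exact h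
    rw [Function.iterate_succ_apply'] at hmem
    have huB : u ∈ (fun B => swReach G B c u)^[n] W := self_mem_iterate_atomStep c hu n
    exact swReach_eq_of_mem c huB hmem

/-- **A vertex of an atom has the same atom.** -/
theorem atom_eq_of_mem {W : Finset V} (c : V → ℕ) {u u' : V} (hu : u ∈ W) (h : u' ∈ atom G W c u) :
    atom G W c u' = atom G W c u := by
  unfold atom
  exact iterate_atomStep_eq_of_mem c hu h _

/-- The atom of a vertex outside `W` is empty. -/
theorem atom_eq_empty_of_not_mem {W : Finset V} (c : V → ℕ) {u : V} (hu : u ∉ W) : atom G W c u = ∅ := by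
  -- round 1 is `swReach G W c u = ∅`, and the rounds decrease
  have hstart : ({u} ∩ W : Finset V) = ∅ := by
    rw [eq_empty_iff_forall_notMem]; intro y hy
    rw [mem_inter, mem_singleton] at hy; exact hu (hy.1 ▸ hy.2)
  have hiter : ∀ n, (swExpand G W c)^[n] (∅ : Finset V) = ∅ := by
    intro n
    induction n with
    | zero => rfl
    | succ n ih =>
      rw [Function.iterate_succ_apply', ih, swExpand, empty_union, filter_eq_empty_iff]
      rintro b - ⟨a, ha, -⟩; simp at ha
  have h1 : (fun B => swReach G B c u)^[1] W = ∅ := by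
    simp only [Function.iterate_one]; unfold swReach; rw [hstart, hiter]
  apply subset_empty.1
  calc atom G W c u ⊆ (fun B => swReach G B c u)^[1] W := by
        unfold atom
        have key : ∀ k, (fun B => swReach G B c u)^[1 + k] W ⊆ (fun B => swReach G B c u)^[1] W := by
          intro k
          induction k with
          | zero => exact Subset.rfl
          | succ k ih => rw [← Nat.add_assoc]; exact (iterate_atomStep_succ_subset W c u _).trans ih
        have := key W.card
        rwa [Nat.add_comm] at this
    _ = ∅ := h1

/-- **Atoms partition the block**: two atoms are equal or disjoint. -/
theorem atom_eq_or_disjoint (W : Finset V) (c : V → ℕ) (u u' : V) :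
    atom G W c u = atom G W c u' ∨ Disjoint (atom G W c u) (atom G W c u') := by
  classical
  by_cases hdis : Disjoint (atom G W c u) (atom G W c u')
  · exact Or.inr hdis
  left
  rw [not_disjoint_iff] at hdis
  obtain ⟨w, hw, hw'⟩ := hdis
  have hu : u ∈ W := by
    by_contra hu; rw [atom_eq_empty_of_not_mem c hu] at hw; exact notMem_empty w hw
  have hu' : u' ∈ W := by
    by_contra hu'; rw [atom_eq_empty_of_not_mem c hu'] at hw'; exact notMem_empty w hw'
  rw [← atom_eq_of_mem c hu hw, atom_eq_of_mem c hu' hw']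

end BranchSum

end Summit.PneNP.PneNP.Theorems
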